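import Summits.BirchSwinnertonDyer.BirchSwinnertonDyer.Theorems.DefiniteThetaDerivedHeightCapIwasawaSerreGrossTower
import HarnessLib

/-!
# The Iwasawa power series of `θ^{ac}` for EVERY number field `K`: the degenerate branch `[K:ℚ] = 1` and the `K`-general summary

Route-independent `Theorems` file (cell `b2b-bsdres`, seat `b2b-bsdres-x10b`, gen 46), part 20 of the series «tower square root»
serving crux `DerivedHeightCap` (stmt-BirchSwinnertonDyer-18438, route DefiniteTheta; definition request D2).
HONEST FRAMING: no curve asserted, no class closed, BSD not proved by any of this.

A tower of Gross points on a definite setup exists only for `[K:ℚ] = 1` or `K` imaginary quadratic (part 9). Part 19 gave, for `K`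
imaginary quadratic and every prime `p`, a power series `L ∈ ℤ_p⟦X⟧` with `ord_J θ^{ac} = ord_X L`, `VanishesToOrderAc ρ ↔ X^ρ ∣ L`,
`HasMuZeroAc ↔ p ∤ L`, `θ_n^{ac} ι(θ_n^{ac}) ∈ I^ρ ∀ n ↔ ρ ≤ 2 ord_X L`. Here:

* §1 `augmentation_thetaAc_eq` — for ANY `K`: along a norm-compatible tower the augmentations `ε(θ_n^{ac})` are all equal (to `ε(θ_0^{ac})`);
* §2 the degenerate branch `[K:ℚ] = 1`: every `Pic(𝒪_{p^{n+1}})/Δ` is trivial (part 10), `θ_n^{ac} = ε(θ_0^{ac}) · 1`, and the CONSTANT power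
  series `L := C (ε θ_0^{ac})` has the four properties (`vanishesToOrderAc_iff_of_finrank_eq_one`, `acOrderOfVanishing_eq_of_finrank_eq_one`,
  `hasMuZeroAc_iff_of_finrank_eq_one`, `forall_thetaAc_mul_inv_mem_iff_of_finrank_eq_one`);
* §3 ★★ `exists_powerSeries_acOrderOfVanishing_eq_order_anyField`: **for EVERY number field `K`, EVERY prime `p` and every tower of Gross
  points with norm-compatible theta elements there is `L ∈ ℤ_p⟦X⟧` with `T.acOrderOfVanishing p φ α = ord_X L`,
  `T.VanishesToOrderAc p φ α ρ ↔ X^ρ ∣ L`, `T.HasMuZeroAc p φ α ↔ p ∤ L`, `θ_n^{ac}ι(θ_n^{ac}) ∈ I^ρ ∀ n ↔ ρ ≤ 2 ord_X L`** — the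
  generality (all `K`, all `p`) of the registered stubs of the line «birth».

## References
* [BertoliniDarmon2005] §1.2 (18)–(21), Def. 1.6, Cor. 3; [BertoliniDarmon1996] Prop. 2.7, §2.12; [Washington1997] §7.1 Thm. 7.1.
-/

noncomputable section

open scoped BigOperators Polynomial

-- D-0017: single-problem summit, the namespace repeats the problem name by design.
set_option linter.dupNamespace false

namespace Summit.BirchSwinnertonDyer.BirchSwinnertonDyer.Theorems.TowerSqrt

open Literature.NumberTheory.EllipticCurves Literature.NumberTheory.EllipticCurves.QuadOrderTower NumberField
  Literature.NumberTheory.Automorphic Module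
open Summit.BirchSwinnertonDyer.BirchSwinnertonDyer.Theorems.DefmuSupersingularTheta (isUnit_iff_not_dvd)

universe u

variable {K : Type u} [Field K] [NumberField K] (p : ℕ) [hp : Fact p.Prime]
  {Nplus Nminus : ℕ} {S : Brandt.XiSetup Nplus Nminus}
  (φ : Brandt.ClassSet S.O → ℤ) (α : ℤ_[p]ˣ) (T : GrossPointTower K S p)

/-! ### §1 The augmentations of the `θ_n^{ac}` are constant along a norm-compatible tower (any `K`) -/

/-- `ε(θ_n^{ac}) = ε(θ_n)`: the anticyclotomic projection does not change the augmentation. [folklore] -/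
theorem augmentation_thetaAc (n : ℕ) :
    augmentation ℤ_[p] (AcLayerGroup K p (n + 1)) (T.thetaAc p φ α n) =
      augmentation ℤ_[p] (ClassGroup (quadOrder K (p ^ (n + 1)))) (T.theta p φ α n) := by
  have := RingHom.congr_fun (augmentation_comp_mapDomainRingHom ℤ_[p] (ClassGroup (quadOrder K (p ^ (n + 1)))) (acProj K p (n + 1)))
    (T.theta p φ α n)
  rw [RingHom.comp_apply, RingHom.coe_coe, RingHom.coe_coe] at this
  exact this

/-- **Along a norm-compatible tower all augmentations agree**: `ε(θ_n^{ac}) = ε(θ_0^{ac})` for every `n` (`ε ∘ π_* = ε`, BD96 Prop. 2.7).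
[cite: BertoliniDarmon1996, Prop. 2.7 and §2.7] -/
theorem augmentation_thetaAc_eq (hnc : T.IsNormCompatible p φ α) (n : ℕ) :
    augmentation ℤ_[p] (AcLayerGroup K p (n + 1)) (T.thetaAc p φ α n) =
      augmentation ℤ_[p] (AcLayerGroup K p 1) (T.thetaAc p φ α 0) := by
  rw [augmentation_thetaAc, augmentation_thetaAc]
  induction n with
  | zero => rfl
  | succ n ih =>
    rw [← ih, ← (mem_completedGroupRing_iff (K := K) (p := p)).mp hnc n, groupRingProj]
    have := RingHom.congr_fun (augmentation_comp_mapDomainRingHom ℤ_[p] (ClassGroup (quadOrder K (p ^ (n + 1 + 1))))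
      (picRes K (pow_dvd_pow p (n + 1).le_succ))) (T.theta p φ α (n + 1))
    rw [RingHom.comp_apply, RingHom.coe_coe, RingHom.coe_coe] at this
    exact this.symm

/-! ### §2 The degenerate branch `[K:ℚ] = 1`: the constant power series `C (ε θ_0^{ac})` -/

section Degenerate

omit hp in
/-- Over a trivial group, membership in `I^ρ` (`ρ ≥ 1`) is the vanishing of the augmentation. [folklore] -/
theorem mem_augIdeal_pow_iff_of_subsingleton [Fact p.Prime] {G : Type*} [CommGroup G] [Subsingleton G]
    (θ : MonoidAlgebra ℤ_[p] G) {ρ : ℕ} (hρ : 0 < ρ) :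
    θ ∈ augIdeal ℤ_[p] G ^ ρ ↔ augmentation ℤ_[p] G θ = 0 := by
  constructor
  · intro h
    exact (mem_augIdeal_iff _ _).mp (Ideal.pow_le_self hρ.ne' h)
  · intro h
    rw [eq_single_augmentation_of_subsingleton θ, h, MonoidAlgebra.single_zero]
    exact Ideal.zero_mem _

/-- `X^ρ ∣ C c` in `ℤ_p⟦X⟧` iff `ρ = 0` or `c = 0`. [folklore] -/
theorem X_pow_dvd_C_iff (c : ℤ_[p]) (ρ : ℕ) :
    (PowerSeries.X : PowerSeries ℤ_[p]) ^ ρ ∣ PowerSeries.C c ↔ ρ = 0 ∨ c = 0 := by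
  rw [PowerSeries.X_pow_dvd_iff]
  constructor
  · intro h
    rcases Nat.eq_zero_or_pos ρ with h0 | hpos
    · exact Or.inl h0
    · right; simpa [PowerSeries.coeff_C] using h 0 hpos
  · rintro (rfl | rfl) m hm
    · exact absurd hm (Nat.not_lt_zero m)
    · simp

/-- `C p ∣ C c` in `ℤ_p⟦X⟧` iff `p ∣ c`. [folklore] -/
theorem C_p_dvd_C_iff (c : ℤ_[p]) :
    (PowerSeries.C (p : ℤ_[p]) : PowerSeries ℤ_[p]) ∣ PowerSeries.C c ↔ (p : ℤ_[p]) ∣ c := by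
  constructor
  · rintro ⟨M, hM⟩
    have := congrArg (PowerSeries.coeff 0) hM
    rw [PowerSeries.coeff_C_mul, PowerSeries.coeff_zero_C] at this
    exact ⟨_, this⟩
  · rintro ⟨d, rfl⟩
    exact ⟨PowerSeries.C d, by rw [map_mul]⟩

variable {p φ α T}

/-- `[K:ℚ] = 1`: every layer group `Pic(𝒪_{p^{n+1}})/Δ` is trivial (part 10). [folklore] -/
theorem subsingleton_acLayerGroup_of_finrank_eq_one (h1 : finrank ℚ K = 1) (n : ℕ) : Subsingleton (AcLayerGroup K p (n + 1)) := by
  -- local instance: keep the typeclass search for the quotient away from `IsCyclic.isMulCommutative` (part 8)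
  haveI : ∀ m : ℕ, IsMulCommutative (ClassGroup (quadOrder K (p ^ m))) := fun m => CommMagma.to_isCommutative
  haveI : Subsingleton (ClassGroup (quadOrder K (p ^ (n + 1)))) := subsingleton_classGroup_quadOrder h1 _
  exact (QuotientGroup.mk'_surjective (torsionImage K p (n + 1))).subsingleton

/-- `[K:ℚ] = 1`: `θ_n^{ac} ∈ I^ρ` for all `n` iff `X^ρ` divides the constant power series `C (ε θ_0^{ac})`. [cite: BertoliniDarmon2005, §1.2 (18)–(21)] -/
theorem vanishesToOrderAc_iff_of_finrank_eq_one (h1 : finrank ℚ K = 1) (hnc : T.IsNormCompatible p φ α) (ρ : ℕ) :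
    T.VanishesToOrderAc p φ α ρ ↔ (PowerSeries.X : PowerSeries ℤ_[p]) ^ ρ ∣
      PowerSeries.C (augmentation ℤ_[p] (AcLayerGroup K p 1) (T.thetaAc p φ α 0)) := by
  rw [X_pow_dvd_C_iff]
  rcases Nat.eq_zero_or_pos ρ with h0 | hpos
  · subst h0
    exact ⟨fun _ => Or.inl rfl, fun _ => GrossPointTower.vanishesToOrderAc_zero p φ α T⟩
  · unfold GrossPointTower.VanishesToOrderAc
    constructor
    · intro h
      right
      haveI := subsingleton_acLayerGroup_of_finrank_eq_one (p := p) h1 0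
      exact (mem_augIdeal_pow_iff_of_subsingleton p _ hpos).mp (h 0)
    · rintro (h | h) n
      · omega
      · haveI := subsingleton_acLayerGroup_of_finrank_eq_one (p := p) h1 n
        rw [mem_augIdeal_pow_iff_of_subsingleton p _ hpos, augmentation_thetaAc_eq p φ α T hnc n, h]

/-- `[K:ℚ] = 1`: `ord_J θ^{ac} = ord_X C(ε θ_0^{ac})` (`= ⊤` if `ε θ_0^{ac} = 0`, else `0`). [cite: BertoliniDarmon2005, §1.2 (18)–(21)] -/
theorem acOrderOfVanishing_eq_of_finrank_eq_one (h1 : finrank ℚ K = 1) (hnc : T.IsNormCompatible p φ α) :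
    T.acOrderOfVanishing p φ α = (PowerSeries.C (augmentation ℤ_[p] (AcLayerGroup K p 1) (T.thetaAc p φ α 0))).order := by
  have key : ∀ ρ : ℕ, T.VanishesToOrderAc p φ α ρ ↔
      (ρ : ℕ∞) ≤ (PowerSeries.C (augmentation ℤ_[p] (AcLayerGroup K p 1) (T.thetaAc p φ α 0))).order := fun ρ =>
    (vanishesToOrderAc_iff_of_finrank_eq_one h1 hnc ρ).trans (X_pow_dvd_iff_le_order p _ ρ)
  unfold GrossPointTower.acOrderOfVanishing
  refine le_antisymm (iSup₂_le fun ρ hρ => (key ρ).mp hρ) (ENat.forall_natCast_le_iff_le.mp fun m hm => ?_)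
  exact le_iSup₂ (f := fun (ρ : ℕ) (_ : T.VanishesToOrderAc p φ α ρ) => (ρ : ℕ∞)) m ((key m).mpr hm)

/-- `[K:ℚ] = 1`: `μ(θ^{ac}) = 0` iff `p ∤ C(ε θ_0^{ac})`, i.e. iff `ε θ_0^{ac}` is a unit. [cite: BertoliniDarmon2005, §1.2 (18)–(21)] -/
theorem hasMuZeroAc_iff_of_finrank_eq_one (h1 : finrank ℚ K = 1) (hnc : T.IsNormCompatible p φ α) :
    T.HasMuZeroAc p φ α ↔ ¬ (PowerSeries.C (p : ℤ_[p]) : PowerSeries ℤ_[p]) ∣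
      PowerSeries.C (augmentation ℤ_[p] (AcLayerGroup K p 1) (T.thetaAc p φ α 0)) := by
  rw [C_p_dvd_C_iff, ← isUnit_iff_not_dvd]
  -- every coefficient of every `θ_n^{ac}` is `ε θ_0^{ac}`
  have hcoeff : ∀ n (g : AcLayerGroup K p (n + 1)), (T.thetaAc p φ α n).coeff g =
      augmentation ℤ_[p] (AcLayerGroup K p 1) (T.thetaAc p φ α 0) := by
    intro n g
    haveI := subsingleton_acLayerGroup_of_finrank_eq_one (p := p) h1 n
    rw [← augmentation_thetaAc_eq p φ α T hnc n]
    conv_lhs => rw [eq_single_augmentation_of_subsingleton (T.thetaAc p φ α n)]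
    rw [MonoidAlgebra.coeff_single, Finsupp.single_apply, if_pos (Subsingleton.elim _ _)]
  unfold GrossPointTower.HasMuZeroAc
  constructor
  · rintro ⟨n₀, h⟩
    obtain ⟨g, hg⟩ := h n₀ le_rfl
    rwa [hcoeff] at hg
  · intro h
    exact ⟨0, fun n _ => ⟨1, by rwa [hcoeff]⟩⟩

/-- `[K:ℚ] = 1`: `θ_n^{ac} ι(θ_n^{ac}) ∈ I^ρ ∀ n ↔ ρ ≤ 2 ord_X C(ε θ_0^{ac})`. [cite: BertoliniDarmon2005, §1.2 (18)–(21)] -/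
theorem forall_thetaAc_mul_inv_mem_iff_of_finrank_eq_one (h1 : finrank ℚ K = 1) (hnc : T.IsNormCompatible p φ α) (ρ : ℕ) :
    (∀ n : ℕ, T.thetaAc p φ α n * MonoidAlgebra.mapDomain (fun σ => σ⁻¹) (T.thetaAc p φ α n) ∈
        augIdeal ℤ_[p] (AcLayerGroup K p (n + 1)) ^ ρ) ↔
      (ρ : ℕ∞) ≤ (PowerSeries.C (augmentation ℤ_[p] (AcLayerGroup K p 1) (T.thetaAc p φ α 0))).order +
        (PowerSeries.C (augmentation ℤ_[p] (AcLayerGroup K p 1) (T.thetaAc p φ α 0))).order := by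
  set c := augmentation ℤ_[p] (AcLayerGroup K p 1) (T.thetaAc p φ α 0) with hc
  rcases Nat.eq_zero_or_pos ρ with h0 | hpos
  · subst h0
    simp only [pow_zero, Ideal.one_eq_top, Submodule.mem_top, forall_const, Nat.cast_zero, zero_le]
  by_cases hc0 : c = 0
  · -- everything vanishes
    have hC : PowerSeries.C c = 0 := by rw [hc0, map_zero]
    rw [hC, PowerSeries.order_zero, top_add]
    simp only [le_top, iff_true]
    intro n
    haveI := subsingleton_acLayerGroup_of_finrank_eq_one (p := p) h1 n
    rw [mem_augIdeal_pow_iff_of_subsingleton p _ hpos, map_mul, augmentation_mapDomain_inv, augmentation_thetaAc_eq p φ α T hnc n,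
      ← hc, hc0, mul_zero]
  · -- `c ≠ 0`: the order is `0` and `ε(θ_0 ιθ_0) = c² ≠ 0`
    have hord : (PowerSeries.C c).order = 0 := by
      refine le_antisymm ?_ zero_le
      have := PowerSeries.order_le (φ := PowerSeries.C c) 0 (by rwa [PowerSeries.coeff_zero_C])
      exact_mod_cast this
    rw [hord, add_zero]
    constructor
    · intro h
      exfalso
      haveI := subsingleton_acLayerGroup_of_finrank_eq_one (p := p) h1 0
      have h0 := (mem_augIdeal_pow_iff_of_subsingleton p _ hpos).mp (h 0)
      rw [map_mul, augmentation_mapDomain_inv, ← hc] at h0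
      exact hc0 (mul_self_eq_zero.mp h0)
    · intro h
      exfalso
      have : ρ = 0 := by exact_mod_cast (nonpos_iff_eq_zero.mp h)
      omega

end Degenerate

/-! ### §3 Every number field `K`, every prime `p` -/

/-- ★★ **The anticyclotomic theta tower is a power series — for EVERY number field `K` and EVERY prime `p`.** For a tower of Gross points
on a definite setup whose theta elements are norm-compatible there is `L ∈ ℤ_p⟦X⟧` with `T.acOrderOfVanishing p φ α = ord_X L`,
`T.VanishesToOrderAc p φ α ρ ↔ X^ρ ∣ L` for all `ρ`, `T.HasMuZeroAc p φ α ↔ p ∤ L`, and `θ_n^{ac} ι(θ_n^{ac}) ∈ I^ρ ∀ n ↔ ρ ≤ 2 ord_X L`: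
a tower forces `[K:ℚ] = 1` (§2: `L` constant) or `K` imaginary quadratic (part 19: `L = L_f`), by part 9.
[cite: BertoliniDarmon2005, §1.2 (18)–(21) and Cor. 3] [cite: Washington1997, §7.1 Thm. 7.1] -/
theorem exists_powerSeries_acOrderOfVanishing_eq_order_anyField :
    ∀ (K : Type) [Field K] [NumberField K] (p : ℕ) [Fact p.Prime] (Nplus Nminus : ℕ) (S : Brandt.XiSetup Nplus Nminus)
      (T : GrossPointTower K S p) (φ : Brandt.ClassSet S.O → ℤ) (α : ℤ_[p]ˣ), T.IsNormCompatible p φ α →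
      ∃ L : PowerSeries ℤ_[p],
        T.acOrderOfVanishing p φ α = L.order ∧
        (∀ ρ : ℕ, T.VanishesToOrderAc p φ α ρ ↔ (PowerSeries.X : PowerSeries ℤ_[p]) ^ ρ ∣ L) ∧
        (T.HasMuZeroAc p φ α ↔ ¬ (PowerSeries.C (p : ℤ_[p]) : PowerSeries ℤ_[p]) ∣ L) ∧
        (∀ ρ : ℕ, (∀ n : ℕ, T.thetaAc p φ α n * MonoidAlgebra.mapDomain (fun σ => σ⁻¹) (T.thetaAc p φ α n) ∈
            augIdeal ℤ_[p] (AcLayerGroup K p (n + 1)) ^ ρ) ↔ (ρ : ℕ∞) ≤ L.order + L.order) := by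
  intro K _ _ p _ Nplus Nminus S T φ α hnc
  rcases finrank_eq_one_or_isImaginaryQuadratic_of_grossPointTower S T with h1 | hK
  · exact ⟨_, acOrderOfVanishing_eq_of_finrank_eq_one h1 hnc, vanishesToOrderAc_iff_of_finrank_eq_one h1 hnc,
      hasMuZeroAc_iff_of_finrank_eq_one h1 hnc, forall_thetaAc_mul_inv_mem_iff_of_finrank_eq_one h1 hnc⟩
  · exact exists_powerSeries_acOrderOfVanishing_eq_order p φ α T hK hnc

end Summit.BirchSwinnertonDyer.BirchSwinnertonDyer.Theorems.TowerSqrt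

end
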